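import Literature.Geometry.Symplectic.SteinShapeCriterion
import Literature.Geometry.Symplectic.SteinShapeInequalities
import HarnessLib

/-!
# Eliashberg's handlebody `K = {|x| ≤ h(|y|)} ⊂ ℂ²` is strongly pseudoconvex

Topic `Literature/Geometry/Symplectic`; proofs file of the fact seat of
`Literature.Geometry.Symplectic.Gompf1998_thm13_twoHandles` (**E2**, `SteinTwoHandles.lean`).
Forstnerič–Kozak 2003, Cor. 3.2 (= Eliashberg 1990, Lemma 3.4.3, the geometric content of
the attachment of a Stein `2`-handle in `ℂ²`): for a profile `h : ℝ → ℝ` which is `C^∞`,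
constant `= σ > 0` on `u ≤ r₀` (`r₀ > 0`), `≥ σ` everywhere and satisfies the inequalities (3.1)
`h (h'' + h'³/u) < 1`, `h h'/u < 1` at every `u > 0` — such profiles exist with the tail of the
quadric `D_λ` by `HParam.exists_handle_profile` (`SteinHandleProfileInverse.lean`) — the
handlebody `K = {x + iy ∈ ℂ² : |x| ≤ h(|y|)}` has **strongly pseudoconvex boundary from the
inside**: with `θ_K(s) = h(√s)²` (a `C^∞` function, constant near `s ≤ 0`) and the defining
function `ρ_K = |x|² - θ_K(|y|²)` (`spherical θ_K` of `SteinShapeCriterion.lean`, real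
coordinates `x = (u₀, u₁)`, `y = (u₂, u₃)`, `J₁∂_{u₀} = ∂_{u₂}`), at every point of
`∂K = {ρ_K = 0}` the flat Levi form of `ρ_K` is positive on the complex tangency
(`levi_handleDomain_pos`), i.e. `-dd^ℂρ_K(v, J₁v) > 0` there
(`neg_extDeriv_dComplexFlat_handleDomain_pos`).  Over `y ≠ 0` this is Forstnerič–Kozak's
Cor. 2.2 criterion (`shape_theta_iff` + `levi_spherical_pos`); over the core disc `y = 0`,
where `K` is the tube `{|x| ≤ σ}`, it is immediate.

Everything is **proved**; one definition (`thetaK`) and the hypothesis package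
`HandleProfile`, no named fact.

## References

* F. Forstnerič, J. Kozak, *Strongly pseudoconvex handlebodies*, J. Korean Math. Soc. 40
  (2003), 727–745 (arXiv:math/0305237), Cor. 2.2, Prop. 3.1, Cor. 3.2. [ForstnericKozak2003]
* Ya. Eliashberg, *Topological characterization of Stein manifolds of dimension > 2*,
  Internat. J. Math. 1 (1990), 29–46, Lemma 3.4.3. [Eliashberg1990Stein]
-/

noncomputable section

open scoped Manifold ContDiff Topology
open Set Function Filter

namespace Literature.Geometry.Symplectic

local notation "E4" => EuclideanSpace ℝ (Fin 4)

/-! ### The profile hypotheses and the function `θ_K` -/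

/-- The hypotheses on the profile `h` of the handlebody `K = {|x| ≤ h(|y|)}`: `C^∞`, equal to
`σ > 0` on `u ≤ r₀` (`r₀ > 0`), `≥ σ`, and the inequalities (3.1) of Forstnerič–Kozak at every
`u > 0`. [cite: ForstnericKozak2003, Prop. 3.1] -/
structure HandleProfile (h : ℝ → ℝ) (σ r₀ : ℝ) : Prop where
  smooth : ContDiff ℝ ∞ h
  σ_pos : 0 < σ
  r₀_pos : 0 < r₀
  eq_σ : ∀ u, u ≤ r₀ → h u = σ
  σ_le : ∀ u, σ ≤ h u
  shape : ∀ u, 0 < u → h u * (deriv (deriv h) u + deriv h u ^ 3 / u) < 1 ∧ h u * deriv h u / u < 1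

/-- **`θ_K(s) = h(√s)²`**, so that `K = {|x|² ≤ θ_K(|y|²)}`. [cite: ForstnericKozak2003, §2] -/
def thetaK (h : ℝ → ℝ) : ℝ → ℝ := fun s => h (Real.sqrt s) ^ 2

/-- Unfolding. [folklore] -/
theorem thetaK_apply (h : ℝ → ℝ) (s : ℝ) : thetaK h s = h (Real.sqrt s) ^ 2 := rfl

namespace HandleProfile

variable {h : ℝ → ℝ} {σ r₀ : ℝ} (H : HandleProfile h σ r₀)
include H

/-- `h > 0`. [folklore] -/
theorem pos (u : ℝ) : 0 < h u := lt_of_lt_of_le H.σ_pos (H.σ_le u)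

/-- `θ_K = σ²` on `s ≤ r₀²` (in particular near `s ≤ 0`). [folklore] -/
theorem thetaK_of_le {s : ℝ} (hs : s ≤ r₀ ^ 2) : thetaK h s = σ ^ 2 := by
  rw [thetaK_apply, H.eq_σ]
  rw [← Real.sqrt_sq H.r₀_pos.le]
  exact Real.sqrt_le_sqrt hs

/-- `θ_K` is locally constant `= σ²` near every `s < r₀²`. [folklore] -/
theorem thetaK_eventuallyEq {s : ℝ} (hs : s < r₀ ^ 2) : thetaK h =ᶠ[𝓝 s] fun _ => σ ^ 2 := by
  filter_upwards [Iio_mem_nhds hs] with s' hs' using H.thetaK_of_le hs'.le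

/-- `θ_K > 0`. [folklore] -/
theorem thetaK_pos (s : ℝ) : 0 < thetaK h s := by rw [thetaK_apply]; exact pow_pos (H.pos _) 2

/-- **`θ_K` is `C^∞`** (constant near `s ≤ 0`, `(h ∘ √·)²` on `s > 0`). [folklore] -/
theorem contDiff_thetaK : ContDiff ℝ ∞ (thetaK h) := by
  rw [contDiff_iff_contDiffAt]
  intro s
  rcases lt_or_ge s (r₀ ^ 2) with hs | hs
  · exact contDiffAt_const.congr_of_eventuallyEq (H.thetaK_eventuallyEq hs)
  · have hs0 : 0 < s := lt_of_lt_of_le (pow_pos H.r₀_pos 2) hs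
    have h1 : ContDiffAt ℝ ∞ Real.sqrt s := Real.contDiffAt_sqrt hs0.ne'
    exact (H.smooth.contDiffAt.comp s h1).pow 2

/-- `θ_K' = θ_K'' = 0` at `s < r₀²`. [folklore] -/
theorem deriv_thetaK_of_lt {s : ℝ} (hs : s < r₀ ^ 2) :
    deriv (thetaK h) s = 0 ∧ deriv (deriv (thetaK h)) s = 0 := by
  have hev := H.thetaK_eventuallyEq hs
  constructor
  · rw [hev.deriv_eq]; exact deriv_const s _
  · have : deriv (thetaK h) =ᶠ[𝓝 s] fun _ => (0 : ℝ) := by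
      filter_upwards [hev.eventually_nhds] with s' hs'
      rw [(show thetaK h =ᶠ[𝓝 s'] fun _ => σ ^ 2 from hs').deriv_eq]; exact deriv_const s' _
    rw [this.deriv_eq]; exact deriv_const s _

/-! ### Strong pseudoconvexity of `∂K` -/

/-- **Eliashberg's handlebody is strongly pseudoconvex (Forstnerič–Kozak, Cor. 3.2 with
Cor. 2.2; Eliashberg 1990, Lemma 3.4.3).**  At every point `u` of `∂K = {ρ_K = 0}`,
`ρ_K = |x|² - θ_K(|y|²)`, the flat Levi form of `ρ_K` is positive on the complex tangency:
`D²ρ_K(v,v) + D²ρ_K(J₁v,J₁v) > 0` for `v ≠ 0` with `dρ_K(v) = dρ_K(J₁v) = 0`; i.e. the interior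
`{ρ_K < 0} = {|x| < h(|y|)}` of `K` is strongly pseudoconvex at `u`. [cite: ForstnericKozak2003, Cor. 3.2] -/
theorem levi_handleDomain_pos {u : E4} (hρ : spherical (thetaK h) u = 0) {v : E4} (hv : v ≠ 0)
    (h1 : fderiv ℝ (spherical (thetaK h)) u v = 0)
    (h2 : fderiv ℝ (spherical (thetaK h)) u (scaledComplexStructure 1 v) = 0) :
    0 < fderiv ℝ (fderiv ℝ (spherical (thetaK h))) u v v +
      fderiv ℝ (fderiv ℝ (spherical (thetaK h))) u (scaledComplexStructure 1 v)
        (scaledComplexStructure 1 v) := by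
  have hθ2 : ContDiff ℝ 2 (thetaK h) := H.contDiff_thetaK.of_le (by norm_cast)
  set s := u 2 ^ 2 + u 3 ^ 2 with hsdef
  have hθpos : 0 < thetaK h s := H.thetaK_pos s
  rcases lt_or_ge s (r₀ ^ 2) with hs | hs
  · -- over (a neighbourhood of) the core disc: `θ_K` is constant
    obtain ⟨hd1, hd2⟩ := H.deriv_thetaK_of_lt hs
    refine levi_spherical_pos hθ2 hρ hθpos (by rw [hd1]; norm_num) ?_ hv h1 h2
    rw [hd1, hd2]
    simpa using hθpos
  · -- `|y| ≥ r₀ > 0`: Cor. 2.2 of Forstnerič–Kozak via (3.1) for `h` at `√s`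
    have hs0 : 0 < s := lt_of_lt_of_le (pow_pos H.r₀_pos 2) hs
    have hr : 0 < Real.sqrt s := Real.sqrt_pos.2 hs0
    have hd : ∀ r, HasDerivAt h (deriv h r) r := fun r =>
      (H.smooth.differentiable (by simp)).differentiableAt.hasDerivAt
    have hdd : HasDerivAt (deriv h) (deriv (deriv h) (Real.sqrt s)) (Real.sqrt s) := by
      have : ContDiff ℝ ∞ (deriv h) := H.smooth.iterate_deriv 1
      exact (this.differentiable (by simp)).differentiableAt.hasDerivAt
    have key := (shape_theta_iff (f := h) (f' := deriv h) hs0 (H.pos _)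
      (Eventually.of_forall hd) hdd).2 ⟨(H.shape _ hr).2, (H.shape _ hr).1⟩
    -- `shape_theta_iff` speaks about `fun s => h (√s)²`, which is `thetaK h`
    have hθeq : (fun s => h (Real.sqrt s) ^ 2) = thetaK h := rfl
    rw [hθeq] at key
    exact levi_spherical_pos hθ2 hρ hθpos key.1 key.2 hv h1 h2

/-- **The same in the tree's `-dd^ℂ` language**: `-dd^ℂρ_K(v, J₁v) > 0` on the complex tangency
of `∂K` (`dComplexFlat`). [cite: ForstnericKozak2003, Cor. 3.2] -/
theorem neg_extDeriv_dComplexFlat_handleDomain_pos {u : E4} (hρ : spherical (thetaK h) u = 0)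
    {v : E4} (hv : v ≠ 0) (h1 : fderiv ℝ (spherical (thetaK h)) u v = 0)
    (h2 : fderiv ℝ (spherical (thetaK h)) u (scaledComplexStructure 1 v) = 0) :
    0 < -(extDeriv (dComplexFlat (scaledComplexStructure 1) (spherical (thetaK h))) u
        ![v, scaledComplexStructure 1 v]) := by
  rw [neg_extDeriv_dComplexFlat_self _ (contDiff_spherical H.contDiff_thetaK)
    (scaledComplexStructure_sq one_ne_zero) u v]
  exact H.levi_handleDomain_pos hρ hv h1 h2

/-- **The differential of `ρ_K` does not vanish on `∂K`** (so `∂K` is a smooth real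
hypersurface and `ρ_K` a defining function): at `u ∈ ∂K`, `dρ_K(u)(x, 0) = 2|x|² = 2θ_K > 0`.
[folklore] -/
theorem fderiv_spherical_thetaK_ne_zero {u : E4} (hρ : spherical (thetaK h) u = 0) :
    fderiv ℝ (spherical (thetaK h)) u ≠ 0 := by
  have hθd : Differentiable ℝ (thetaK h) := H.contDiff_thetaK.differentiable (by simp)
  intro hz
  -- evaluate on the radial vector `w = (u₀, u₁, 0, 0)`
  set w : E4 := (WithLp.equiv 2 (Fin 4 → ℝ)).symm ![u 0, u 1, 0, 0] with hw
  have hw0 : w 0 = u 0 := rfl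
  have hw1 : w 1 = u 1 := rfl
  have hw2 : w 2 = 0 := rfl
  have hw3 : w 3 = 0 := rfl
  have h1 := fderiv_spherical_apply hθd u w
  rw [hz, hw0, hw1, hw2, hw3] at h1
  simp only [zero_apply, mul_zero, add_zero, sub_zero] at h1
  have hx : u 0 ^ 2 + u 1 ^ 2 = thetaK h (u 2 ^ 2 + u 3 ^ 2) := by
    have := hρ; rw [spherical_apply] at this; linarith
  have := H.thetaK_pos (u 2 ^ 2 + u 3 ^ 2)
  nlinarith

end HandleProfile

end Literature.Geometry.Symplectic

end
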